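import Mathlib
import HarnessLib
import HarnessLib.Audit
import Summits.Ventures.CertifiedManyBodySolver.Observables.RungLeavesCoverage

/-!
Route: CovLa214M2b

# Route CovLa214M2b — hubbard-m2-certneg-1 — certified T = 0 flux-stiffness ceiling below 0.98 ×
kinematic on the La₂CuO₄ parent box La214-E (M2(b), n = 1), by the two apex fans of the f-sum
station U = 29/5

It suffices to show X = X1 ∧ X2, the two APEX-FAN shadows of the La₂CuO₄ parent box «La214-E» =
[t′/t, U/t, n] = [−3/10, −1/5] × [29/5, 74/5] × {1}
(`Downfold/BoxesLa214V115M2b`, MO-S2 rung leaf «MOS2-la214-M2b», p602446) seen from the f-sum apex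
station U_A = 29/5: X1 (`SegmentFanCeiling`) = every
box target (t′, U) whose apex source s = t′(2 − (29/5)/U) lies in the box segment [−3/10, −1/5] (21
% of the box area, hugging the bottom edge and the
t′ = −1/5 side up to U = 11.6) carries the certified T = 0 flux-stiffness ceiling
`ObsStiffnessSeqCeilingAt t′ U 1 (4364687/10⁷)`; X2 (`TransportFanCeiling`)
= every target whose source leaves the box (−357/740 ≤ s ≤ −3/10; 79 % of the area) carries the same
ceiling. The bar 0.4364687 = 0.98 × the
premise-free box kinematic word 0.4453763 (director R8 «content»). No summit card is realised
(write_cruxes []; the crux-idea cards «certified charge-gap /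
Drude-weight floor at n = 1» and «SW-dressed f-sum ceiling = one local Krylov step» are filed on the
crux items after open). HONEST FRAMING: a one-sided
stiffness CEILING on a downfolded box is CONTROL / CALIBRATION + labelled heuristic (print: La₂CuO₄
is an AF Mott insulator); a ceiling never speaks to
presence or to ρ_s = 0; no T_c, no phase sentence; no summit statement is proved by this route
(class rung, never summit credit).
Lean: `SegmentFanCeiling ∧ TransportFanCeiling` where `SegmentFanCeiling := ∀ tp ∈ Set.Icc (-3/10 :
ℝ) (-1/5), ∀ U ∈ Set.Icc (29/5 : ℝ) (74/5), -3/10 ≤ tp * (2 - 29/5/U) →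
Summit.Ventures.CertifiedManyBodySolver.Observables.ObsStiffnessSeqCeilingAt tp U 1
(4364687/10000000)` and `TransportFanCeiling := … tp * (2 - 29/5/U) ≤ -3/10 →
Summit.Ventures.CertifiedManyBodySolver.Observables.ObsStiffnessSeqCeilingAt tp U 1
(4364687/10000000)`

## Assembly
Pure logic plus the tree's leaf discharger: `le_total (−3/10) (t′(2 − (29/5)/U))` sends every box
target to one of the two fans, and
`La214M2b_StiffnessBoxCeiling_of_laBoxE_leaf le_rfl` (RungLeavesCoverage, p602446) turns the cell
word at c = bar into the rung leaf
`StiffnessBoxCeilingBelow boxLa214E_M2b (4364687/10⁷)`. The deciding theorem is glue.lean `closes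
(h₁ : SegmentFanCeiling) (h₂ : TransportFanCeiling) :
La214M2b_StiffnessBoxCeiling` (Sketch.lean rc 0, 0 sorry). Conversely the leaf at the bar implies
both fans (conjunct split of the leaf by region; both
conjuncts attacked, neither residual).

CLOSES_TARGET: closes rung MO-S2 of Ventures/CertifiedManyBodySolver: Summit.Ventures.CertifiedManyBodySolver.Observables.La214M2b_StiffnessBoxCeiling (D-0061; not the summit Statement) — the deciding theorem of this route concludes that registered leaf (Ventures/CertifiedManyBodySolver: no summit Statement) (class rung: servable and labelled, never counted as concluding the summit Statement).

Rationale: WHY THIS LINE. Unchanged from rev 0 in mechanism: the f-sum (odd-moment) CEILING on the uniform-flux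
stiffness (Kohn1964; ScalapinoWhiteZhang1993 §II; Lipparini2008 eq. (8.30);
HazraVermaRanderia2019 eqs. (2)–(6)) — ρ_s ≤ the D₄-orbit mean of ⟨−X₀(t′, U)⟩, a kinetic
combination whose torus-limit sector-ground-state expectation is bounded by an
exact rational RDM/moment dual certificate (WangEtAl2024 = arXiv:2310.05844 for the SDP side) and
TRANSPORTED over the box by the apex theorems in tree (U-monotonicity
of the f-sum word along the Hellmann–Feynman apex from ONE station,
`ObsStiffnessSeqCeilingAt_halfFilling_of_forall_apexStation_orbitLower`,
`…_of_apexSource_orbitLower_slot`, StiffnessApexTransport{,Curtain}; half-filling sign lemma t′·K₂ ≤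
0). Imported: many-body sum-rule theory and convex optimisation
(exact duals); nothing sampled. The two cruxes are the director's (KEY D-0154 (1)(C), brief l.21353
(c)): №1 the REGION-VALID dual on the t′-segment at the station
U = 29/5, №2 the t′ ≠ 0 U-transport price. What rev 1 → rev 3 record (route pen g2, 2026-08-28
13:05Z → 14:10Z → 14:55Z): protocol (α′) «K1/K2 LEDGER CLOSURE» (obs STATUS l.2731) has been
EXECUTED FOR BOTH CRUXES — each holder landed a node-parametric closer of the item decl BY NAME
`--supports <item> --as helper`, attached «CLOSED MODULO NODES» evidence and released; the pen
placed `ledger workitem hold <item> --needs "node discharge: …"` (K1 stmt-Ventures-26183 held since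
13:03:21Z, needs re-issued two-tier (α″) 13:59:46Z; K2 stmt-Ventures-26184 held since 13:59:29Z).
THE ROUTE IS CONDITIONALLY COMPLETE MODULO NODES: `closes (h₁ : SegmentFanCeiling) (h₂ :
TransportFanCeiling) : La214M2b_StiffnessBoxCeiling` is certified glue, the Assembly item is closed
proved, and each hypothesis now has an accepted Theorems-closer from kernel-checked CLAIM nodes
(exact-rational pinned-pair dual certificates whose SDP feasibility is checked by the farm reader
in-job + reader-B + referee replay, director R20) — K1:
`Theorems.covLa214M2b_SegmentFanCeiling_of_nodes` (p634911, 7 nodes, tier W, word 0.3870869) and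
`Theorems.covLa214M2b_SegmentFanCeiling_of_kernelWindow_pinS1` (p639228, 1 node, tier K, word
0.4248785); K2: `Theorems.covLa214M2b_TransportFanCeiling_of_nodes` (p639189, 7 nodes, tier W, word
0.4313850) and `Theorems.covLa214M2b_TransportFanCeiling_of_kernelWindow_halfPairs` (p641819, 2
nodes′, tier K, words 0.4259204 / 0.4265286, margin 0.0099401); and the RUNG LEAF itself has an
edition-K theorem `Theorems.La214M2b_StiffnessBoxCeiling_of_threeNodesK` (p642706) whose ONLY
hypotheses are the three pinned-pair certificate nodes′ (pinS1_K, overhangL_K, overhangR_K) — i.e.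
`closes` ∘ (K1-K, K2-K) in one FQN. K2 needs re-issued two-tier (α″) 14:52:18Z. No item text was
edited, nothing is closed `proved` (each item's own signature still depends BY NAME on
`@[conjecture]` nodes), and the class question «certified-conditional closure» is the director's
NEEDS-HUMAN (C) REQUESTS l.22355 (unanswered at 14:55Z). RULE (α″) (obs STATUS l.3208): a held
item's `--needs` names the smallest hypothesis set among its ACCEPTED closers (tiers booked side by
side; the hold lifts only when every node of ONE tier is a theorem; words of record untouched).
Nothing in this revision is summit credit: the route closes the RUNG «MOS2-la214-M2b»
(`Observables.La214M2b_StiffnessBoxCeiling`), never `Summit.*`.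

RANKED CRUXES. #2 SegmentFanCeiling (crux, stmt-Ventures-26183) — SEGMENT FAN of the apex station
U_A = 29/5: ∀ t′ ∈ [−3/10, −1/5], U ∈ [29/5, 74/5] with
−3/10 ≤ t′(2 − (29/5)/U): ObsStiffnessSeqCeilingAt t′ U 1 0.4364687. STATE 2026-08-28T13:05Z:
OPEN-HELD «closed modulo nodes» since 13:03:21Z (hold by the pen; tier-W closer p634911 and tier-K
closer p639228 (ONE node `cert_laBoxE_inner29o5_pinS1_K_up` p638714: the SAME two certificates
j298764/j303210 re-PRICED with their fixed multipliers against kernel floor −4(1+s)… band-bottom,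
2×4-cluster cap plane and the per-letter T′-box theorem
`InfVolFermionState.IsTorusLimitOf.abs_oneSpinDiagBondLetter_le` p636340 — zero solve; edition-K
word 0.4248785 ≤ bar by 0.0116), both `--supports … --as helper`; K1 ROW WORD 0.3870869 for every t′
∈ [−3/10, −1/5] at U = 29/5, δ = 0: the S1 pinned-pair read j306415 printed the cross term L =
0.0071479 (eq 0 + le 0.0071479 + blk 0) ≤ vertex gap g = 0.0195394 ⇒ F0 = β_hub EXACT — sdp-2 RESULT
l.3027, ref-1 (AQ) replay l.3039 + (AR) node tie l.3055 + (AT) closer sign l.3083-region, algo-p2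
second read l.3038, obs-lit re-read l.3031). Producer of record: registered skeleton
`Cruxes/SegmentFanCeiling/Lines/birth.lean` (sha ac575b7f8c0c; stubs `stub_stationWindowA`,
`stub_innerHalfRowA_underBar`; closer
`Downfold.covLa214M2b_SegmentFanCeiling_of_innerBundleRow` / half-row A editions), insurance
`Lines/foot.lean` (K1-from-foot, p625932). Words of record at the
station (INPUTS, conditional by name on claim nodes): hub′ B2 = 0.3870869 at (29/5, 1, −3/10)
(p610595; 11.3 % under the bar), S1 pinned spoke 0.3675475
(j303210; pinning price 0.0002971), Q′ (−1/4 twin) j306842 pending; read law δ = (L_le −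
g)₊²/(4L_le), S1 row PASS iff L_le ≤ 0.235 (captain l.2909).
[difficulty: L] (why it might fail: unchanged — ONE dual must stay feasible and under 0.4365 along a
t′-half-segment; corner floors lose % away from their anchor;
the Lipschitz constant L_le of the row read is the whole risk: the free pair's le-part 0.1585
(j303896) ×(2–4) under pinning [HEUR].)
#3 TransportFanCeiling (crux, stmt-Ventures-26184) — TRANSPORT FAN: ∀ t′ ∈ [−3/10, −1/5], U ∈ [29/5,
74/5] with t′(2 − (29/5)/U) ≤ −3/10:
ObsStiffnessSeqCeilingAt t′ U 1 0.4364687. STATE 14:55Z: OPEN-HELD «closed modulo nodes» since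
13:59:29Z, needs two-tier since 14:52:18Z (hold by the pen; tier-W closer
`Theorems.covLa214M2b_TransportFanCeiling_of_nodes` p639189, commit a2feaf0a350e, engine
`covLa214M2b_TransportFanCeiling_of_overhangBundleRow`, node
`cert_laBoxE_overhang29o5co_boxdual_j307293_up` p638825 + [N2]–[N7]; tier-K closer
`Theorems.covLa214M2b_TransportFanCeiling_of_kernelWindow_halfPairs` p641819 (commit cfa2b7e34c54;
engine `covLa214M2b_TransportFanCeiling_of_kernelWindow_split` p638157) from TWO half-pair nodes′
[M1′] `cert_laBoxE_overhangL29o5_pinS2Mp_K_up` p641357 (outer {S2′ j303208, M′ j306265}, [−357/740,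
−579/1480], word 0.4259204) and [M2′] `cert_laBoxE_overhangR29o5_pinMpHub_K_up` p641405 (inner {M′,
hub′}, [−579/1480, −3/10], word 0.4265286) — the SAME certificates re-PRICED from their κ bytes
against kernel floor/cap literals + the T′-box theorem p636340, zero solve, derivation tied ×4
lineages (ref-1 (BL)/(BO)); K2 ROW WORD 0.4313850 for every s ∈ [−357/740, −3/10] at U = 29/5 with
the corner objective −X₀(−3/10): the S2 pinned-pair read j307293 printed L = 0.1478497 (le only; =
the calibrated law 8·Δt′·|Δκ_cap| to 7 digits) > g = 0.0140079 ⇒ interior Bernstein minimum, δ =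
0.0302903, F0 = −0.4313849931 ⇒ margin to the bar 0.0050837 (1.2 %, THIN) — sdp-2 RESULT l.3255,
captain SCORE l.3257, holder unc-3 g2 release line l.3296-region). Optional second W object (margin
≈ 0.035): the inner-half pinned pair {M′ j306265 = 0.3944107-class, hub′} read j309277 (fired
13:09:52Z) → `TransportFanCeiling_of_innerHalfOverhangRowA1` (p630088); W insurance remains the
inner-half read j309277 (unc-3 g3's object). Producer of record (edition E1): registered skeleton
`Cruxes/TransportFanCeiling/Lines/birth.lean` (sha 0e237d190475; stubs `stub_overhangWindow`,
`stub_overhangRow_underBar`), closer order of record (captain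
l.2909 / l.3073; [a] EXECUTED 13:58Z): [a] S2 full overhang row {hub′ 0.3870869, S2′ pinned
0.4010948 at (29/5, 1, −357/740) (j303208), g = 0.0140079} PASS iff L_le(S2) ≤ 0.168 (read
j307293) → [a′] inner half {M′ (−579/1480) = 0.3944107 + π_M, hub′} PASS iff L_le ≤
0.183/0.172/0.161 (π_M = 0/0.005/0.01), closer
`TransportFanCeiling_of_innerOverhangHalfRowA1` (p626242: the OUTER half is not load-bearing) → [b]
FOOT cell [29/5, 8] × {−3/10} (docc-plane-8 cap of record,
`…leftEdgeFootBoxRowW_doccPlane8`, p628471; foot cap p626795) PASS iff ≤ 0.297/0.254 → [c]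
pocket/strip editions (unc-2). DEAD LINE (recorded, item
unaffected): the far-vertex LENS — own word w₁ = 0.4442344 > 0.4364687 at (−357/740, 29/5, 1)
(j298588). [difficulty: L] (why it might fail: unchanged —
objective/source K₂-mismatch along the overhang; every PASS threshold above is an L_le forecast
[HEUR] until the read prints.)
#1 Assembly (stmt-Ventures-26185) CLOSED proved (`Theorems.covLa214M2bAssembly_proof`); glue `closes
(h₁ : SegmentFanCeiling) (h₂ : TransportFanCeiling) :
La214M2b_StiffnessBoxCeiling` certified (bc6 declared 3 / in-cone 2 / exempt [Assembly]).

TWO-LAYER PLAN. Unchanged and NOT exercised: no `--split` is filed while (α′) holds — the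
half-segment / half-overhang / foot / pocket editions live as `--supports`
closers on the two items (K1: p612376, p613134, p613274, p613729, p625696 located core, p625932
from-foot; K2: p611080 … p624648, p626242 inner-half, p628471 foot
§4), each consuming claim nodes BY NAME; a glued split would only rename the same node dependence.
The three-station ladder (29/5, 8, 11;
`ObsStiffnessSeqCeilingAt_on_laBoxE_of_three_apexStations_orbitLower`) remains the re-split if every
one-station edition misses the bar.

KILL CRITERIA. Unchanged in law (no stiffness FLOOR can come from moments:
StiffnessFloorInvisibleToSpectralMoments), item by item: (i) a certified variational kinetic
floor at a station source forcing every admissible dual value above 0.4364687 refutes that fan's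
witness family (pivot: three-station ladder or a director bar
revision — never a re-worded item); (ii) a certified FLOOR E_L(θ) − E_L(0) ≥ ρθ² with ρ > 0.4364687
along a torus sequence at a box point is `¬ <Decl>` and closes
the route `refuted:<Decl>`; (iii) instrument kills retire LINES not items — executed once:
far-vertex lens (w₁ = 0.4442344 > bar, j298588) DEAD, K2 unaffected.
NODE KILL (new, (α′) bookkeeping): a claim node that fails the farm reader (SDP infeasible / bound
not reproduced) un-holds the item it carries (`workitem hold
--off`), strikes that node from NOT DECOMPOSED YET, and returns the item to its next closer in the
captain's order; it never edits the item text.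

NOT DECOMPOSED YET. = THE NODE LEDGER OF RECORD (what stands between «held, conditionally closed»
and `closed proved` for each item; every entry a kernel-checked
`Certificates/*.lean` claim node or a pending kit leg; director R20 class «INPUT, conditional by
name»): K1 (HELD since 13:03:21Z; closer `Theorems.covLa214M2b_SegmentFanCeiling_of_nodes` p634911):
[N1] `cert_laBoxE_inner29o5_boxdual_j306415_up` (p634728; `TPrimeBundleOrbitLowerRow (29/5) 1
(−3/10) (−1/5) laBoxE_f3o10 laBoxE_f1o5 laBoxE_HI29 F0 (fun s => −oddMomentObsTT s (29/5) 0)`,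
pinned pair {hub j298764 free cert, spoke S1 j303210 pinned}; reader-B algo-p2 CONCUR l.3038,
referee (AQ)/(AR)/(AT), obs-lit re-read l.3031 — registry leg (v) = PEN's call); [N2]
`cert_laBoxE_K2diag_GU29o5n1tpm357o740_j295983_up` (A₁ K₂-law); [N3]
`cert_laBoxE_K2diag_GU29o5n1tpm3o10_j295889_up` (A₂ K₂-law); [N4] `cert_r21_luc_tl_upper_n1_U6`;
[N5] `cert_r487_hubSQ_hanK7R6_U10_r5_e4_so4blk`; [N6] `cert_r427_hubSQ_hanK7_U5_r5_e4_so4blk`; [N7]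
`cert_r488_hubSQ_hanK7R6_U6_r5_e4_so4blk` (t′ = 0 column energy-window nodes). K1 tier K (1 node;
closer p639228): [N1′] `cert_laBoxE_inner29o5_pinS1_K_up` (p638714; `TPrimeBundleOrbitLowerRow
(29/5) 1 (−3/10) (−1/5) (−14/5) (−16/5) (−9634184469/2·10¹⁰) F0′ …`, F0′ =
−1254019830679295715951510116321/2951479051793528258560000000000 = −0.4248785-class; its `_literals`
lemma proves in kernel the re-pricing identity from the claimed β/κ strings). K2 tier W (HELD since
13:59:29Z; closer `Theorems.covLa214M2b_TransportFanCeiling_of_nodes` p639189): [M1]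
`cert_laBoxE_overhang29o5co_boxdual_j307293_up` (p638825, commit bcc7d6987647;
`TPrimeBundleOrbitLowerRow (29/5) 1 (−357/740) (−3/10) laBoxE_f357o740 laBoxE_f3o10 laBoxE_HI29 F0
(fun _ => −oddMomentObsTT (−3/10) (29/5) 0)`, F0 = −0.4313849931 (F0_segment_exact of report.json),
pinned pair {spoke S2 j303208, hub j298764 free cert}; reader ACCEPT main + interior; reader-B /
referee / obs-lit legs as they post) + the SAME [N2]–[N7] as K1. K2 tier K (2 nodes′; closer
p641819): [M1′] `cert_laBoxE_overhangL29o5_pinS2Mp_K_up` (p641357), [M2′]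
`cert_laBoxE_overhangR29o5_pinMpHub_K_up` (p641405). RUNG-LEAF tier K in one FQN:
`Theorems.La214M2b_StiffnessBoxCeiling_of_threeNodesK` (p642706) ⇐ {[N1′], [M1′], [M2′]} — three
reader-checked SDP pinned-pair certificates are ALL that stands between the rung leaf and an
unconditional kernel theorem (sizes: obs-p2 ASSESSMENT l.3318-region — Gram blocks up to 388, ≈
1.5·10⁸ exact products per certificate for an in-kernel replay). A node is DISCHARGED when its
`@[conjecture] def … : Prop` is replaced by a theorem (reader re-run inside Lean, or an accepted
certificate-checker bridge); until then the item stays held. Kinematic facts that are node-FREE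
(proved outright): the slab t′ ≥ −11/40 of the leaf (p620862 / p620185); the located-core theorem
(p625696); the pocket {t′ ∈ [−3/10, −11/40]} × [29/5, 39/5)
is the sole residual of leaf ∧ K1 ∧ K2 bookkeeping (unc-2, pocket = 1/18 of the box). Still producer
business (layer 2): bundle values v(s), the exact
rational certificate format (boxdual/0 reader), a-priori energy windows at the station twins, E1 vs
E2 vs foot for the transport fan. CRUX-IDEA CARDS
(discriminating levers beyond the λ = 0 word class; not load-bearing for this rung): card B
`Cruxes/SegmentFanCeiling/Ideas/doublon-graded-hylleraas-direction.md`
— toy-ED falsifier run 2026-08-28 (route pen g2): EXACT identity [T, J] = 0 ⇒ [H, J] = U[D, J], so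
the «graded» direction ≡ the tree's `oddMomentObsTT` X_λ
(Krylov-1) direction with gain m₁²/m₃; its surviving delta is the smaller-window density ([-4,4]² vs
[-7,7]²); capture of the paramagnetic term 0.68–0.78
[toy/HEUR, 8/10-site ED]; SHARPEN: μ := 11/100 pre-registered for its K-B2 row; card A
`Cruxes/TransportFanCeiling/Ideas/incompressibility-twist-flatness.md` —
literature falsifier: U_c(|t′| ≈ 0.2–0.3, n = 1) = 3–3.25 (PIRG) / 2–3 (VCA) / 5–7
(paramagnetic-constrained CDMFT, QMC, plain VMC) vs box edge 29/5: K-A2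
plausible on the whole box, uncontested for U ≥ 8, method-dependent on the foot strip [29/5, 8).

CHEAPEST FALSIFIER. Rev 0's cheapest check RAN: far-vertex own word w₁ = 0.4442344 ∈ (0.4365,
0.4454) ⇒ lens retired, no audit signal (below the kinematic
0.4453763), item alive (j298588, obs-p2). Rev-1's checks (1)(2) RAN and PASSED: S1 row j306415 L =
0.0071479 ≤ 0.235 (δ = 0); S2 row j307293 L = 0.1478497 ≤ 0.168 (δ = 0.0303, margin 0.0051). What
can still kill, cheapest first (zero compute for this seat): (1) a NODE failing an independent leg —
reader-B (algo-p2) or the referee replay (ref-1) not reproducing `bound == claimed` on the staged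
bytes of [N1]/[M1]/[N1′] strikes that node (NODE KILL above) and un-holds its item; (2) the thin K2
margin: any audit correction > 0.0050837 to the S2 row (e.g. a cap-literal or le re-pricing) flips
[M1]'s word above the bar — the insurance is the inner-half pair j309277 (forecast word ≈ 0.401,
margin ≈ 0.035 [HEUR]) as a second W closer; (3) FOOT-UPIN j306293 printed w₈ = 0.3197909 (spoke)
but the single-cell foot READ forecasts L_le = 0.4415 > 0.297 ⇒ not a closer without a split
(captain) — irrelevant while [a] stands. Own falsifier of the pen's bookkeeping: any own word/chord
> 0.4364687 certified INSIDE the pocket {t′ ∈ [−3/10, −11/40]} × [29/5, 39/5) refutes the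
pocket edition (not the items).

NUMBERS. Box La214-E (V115 edition, `Downfold/BoxesLa214V115M2b`): t′/t ∈ [−3/10, −1/5], U/t ∈
[29/5, 74/5], n = 1; premise-free kinematic box word 0.4453763
(`n1_LaBoxE_stiffnessSeqLeaf_kinematic`), content bar 0.4364687 = 0.98 × (director R8); c⋆ ∈ (0.31,
0.33) separates calibration from discrimination (obs RULING
(xx)) — this rung is CALIBRATION. Words of record (INPUTS, conditional by name on claim nodes): B2
hub′ 0.3870869 (29/5, 1, −3/10) (p610595); S1 pinned
0.3675475 (j303210); S2 pinned 0.4010948 (29/5, 1, −357/740) (j303208; π₂ = 0.0005045); M′ 0.3944107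
(29/5, 1, −579/1480) (j300345 class; cert j306265 pending);
C3 0.3179617 (8, 1, −3/10) (j299520); C2 far corner (74/5, 1, −3/10) node ACCEPTED in tree
(`Certificates/HubbardSquare_LaBoxE_n1_stiffF0_GU74o5n1tpm3o10_j299506.lean`);
ρ_s(6, 1, −3/10) ≤ 0.3798685 (j295893, p604747); far-vertex w₁ = 0.4442344 (j298588, lens dead);
typed fan patches R1/R2/R3 (unc-2, p605973) under the bar on ≈ 39 %
of the box; pocket = 1/18 of the box. NEW (rev 1): K1 inner pinned-pair row (j306415): L =
261168259438625531828838189932777308479590371009027/36537540933272572955092120817907075491398313574400000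
= 0.0071479, g = 0.0195394, δ = 0, F0 =
−70716006870641554349899148639303105784437540417956271/182687704666362864775460604089535377456991567872000000
= −0.3870868431 ⇒ word 0.3870869 (11.3 % under the bar); K2 overhang pinned-pair row (j307293): L =
9244282887324887428724346158576237744687843996397996129/62524866922062690469401391749643482934655364104192000000
= 0.1478497, g = 0.0140079, δ = 0.0302903, F0 = −0.4313849931 ⇒ word 0.4313850 (margin 0.0050837 =
1.2 %); BOX WORD INPUT (E1 one-station cover, reader level) = max(0.3870869, 0.4313850) = 0.4313850
< 0.4364687; K1 edition-K word 0.4248785 (p639228); K2 edition-K words 0.4259204 (outer) / 0.4265286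
(inner) (p641819), tier-K rung max 0.4265286, margin 0.0099401; foot spoke w₈ = 0.3197909 (j306293);
single-cell FOOT forecast L_le = 0.4415 > 0.297 ⇒ would FAIL unsplit [HEUR] (unc-3 l.2991 (3)).
Every number above is a certified f-sum CEILING at a Mott CONTROL/CALIBRATION point or threshold
arithmetic
on such words ([HEUR] only in L_le forecasts); none speaks to ρ_s = 0, T_c or phase; never
«certified true negative».

DEFINITION REQUESTS. None (unchanged). Cite facts wanted: none new.

Novelty: Searches (2026-08-28): `lit search --hybrid "upper bound superfluid weight Drude weight kinetic
energy f-sum rule Hubbard model twisted boundary" -n 8` (8 docs: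
[corpus:book:essler2005-one-dimensional-hubbard-model p.52 eq. (1.A.28) D = −½⟨H₀⟩ −
Σ|⟨n|J|0⟩|²/ω_n], [corpus:book:lipparini2008 p.465], [corpus:book:griffin1995 p.470]); `lit search
"insensitivity of bulk properties to the twisted boundary condition charge gap Drude weight"` (held
[corpus:paper:arxiv-1803.06558 p.9/p.13]: E_θ flatness in U(1)-symmetric gapped phases; crossref
doi:10.1103/physrevb.98.155137, doi:10.1103/physrevb.77.161101 Rigol–Shastry); `lit galaxy search
"bound on the superfluid weight|upper bound on the Drude weight|bound on superfluid stiffness"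
--star all` (0 hits); `lit galaxy search "superfluid weight|Drude weight" --star pdf -n 12` (12
generic hits, none a certified bound: e.g. [galaxy:pdf:-6566843201536857480] Vidmar et al. 1-D Mott
expansion); tree: `ledger route closers --problem Ventures` (26 closers, La214 leaf p602446 not yet
registered), `rg StiffnessBoxCeiling` (RungLeavesCoverage +
Downfold/BoxesLa214V115M2bFan6/FarVertexSlab only), sibling draft cov/hg1201 (CovHg1201M19b, U-slab
split, doped).
Nearest prior art found: HazraVermaRanderia2019 (PRX 9, 031049: D_s ≤ kinetic bound, float
numerics); Essler et al. 2005 eq. (1.A.28) [corpus:book:essler2005-one-dimensional-hubbard-model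
p.52] (the exact Drude-weight formula whose first term is our ceiling); Watanabe 2018
[corpus:paper:arxiv-  [refs: 10.1103/physrevb.98.155137, 10.1103/physrevb.77.161101, 2310.05844, book:essler2005-one-dimensional-hubbard-model, book:lipparini2008, book:griffin1995, paper:arxiv-1803.06558, doi:10.1103/physrevb.98.155137, doi:10.1103/physrevb.77.161101, HazraVermaRanderia2019, WangEtAl2024]

Barriers (technique_class: sdp-lower-bound, sum-rule-moment-ceiling, box-transport): - technique_class: sdp-lower-bound, sum-rule-moment-ceiling, box-transport
- Literature.Barriers.HubbardSuperconductivity.StiffnessFloorInvisibleToSpectralMoments: conceded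
and irrelevant — both items are CEILINGS, which is exactly what finitely many certified moments
give; the crux-idea card «charge-gap floor» is where a floor-type input would enter, and it is not
load-bearing.
- Literature.Barriers.HubbardSuperconductivity.EnergyWindowCeilingResolution: inside its class and
load-bearing — the ceiling resolves only down to the window slack at the station; the bet, priced:
at U = 29/5 the f-sum windows must have slack below 0.009 in ⟨X₀⟩ (2 % of 0.445) for a SHARED dual
(SegmentFanCeiling's why-might-fail) and below 0.003 for the corner-objective overhang
(TransportFanCeiling's) — the calibration corner (6, −3/10) shows 13 % by a point dual [tree:
p604747].
- Literature.Barriers.HubbardSuperconductivity.DegreeFourSosMissesSecondOrderPerturbation: outside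
the dangerous regime — the box starts at U/t = 5.8 where the suppression to certify is NOT
second-order-small (13 % at U = 6); the barrier bites the sibling Hg-1201 low-U slab, not this box.
- Literature.Barriers.HubbardSuperconductivity.StrongCouplingCeiling: adjacent, not binding — a
strong-coupling ceiling on T_c-type quantities; our items are U ≤ 74/5 stiffness ceilings measured
against a kinematic bar, no large-U asymptotics claimed.
- Literature.Barriers.HubbardSuperconductivity.SignProblemNPHard: outside its class — ex

sub-problem: CertifiedManyBodySolver · status: open · opened planner-hubbard-m2-certneg-1-0 2026-08-28T06:25:10Z · rev 3 · ledger route-Ventures-CovLa214M2b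
GENERATED by the gate from the ledger (D-0016/17). Provers cite these decls: `theorem foo : Summit.Ventures.CertifiedManyBodySolver.Theses.CovLa214M2b.<Decl> := …` in Summits/Ventures/CertifiedManyBodySolver/Theorems/<Name>.lean.
-/

namespace Summit.Ventures.CertifiedManyBodySolver.Theses.CovLa214M2b

open scoped BigOperators Topology Manifold Classical MeasureTheory ProbabilityTheory Matrix InnerProductSpace ComplexConjugate ContinuousMap
open Filter Set Function TopologicalSpace MeasureTheory

-- H21.Audit: Ventures rung route — no summit Statement decl; the expected conclusion is the closer leaf tagged below
attribute [summit_statement] _root_.Summit.Ventures.CertifiedManyBodySolver.Observables.La214M2b_StiffnessBoxCeiling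

/-- item stmt-Ventures-26183 · crux · rank 2 · open · by planner
why it might fail: ONE dual must stay feasible and under 0.4365 along a t′-half-segment: corner floors lose % away from their anchor (R12); the station's own-word kinematic scale 0.4426–0.4454 leaves 1.4–2 % to earn by a SHARED dual at U = 29/5 (13 % seen at (6, −3/10) by a point dual).
sources: KomaTasaki1994, ScalapinoWhiteZhang1993, WangEtAl2024, HazraVermaRanderia2019
[crux] SEGMENT FAN of the apex station U_A = 29/5 — for every t′ ∈ [−3/10, −1/5], U ∈ [29/5, 74/5]
with −3/10 ≤ t′(2 − (29/5)/U): the certified sequence-robust flux-stiffness ceiling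
ObsStiffnessSeqCeilingAt t′ U 1 0.4364687 (torus-limit (rectN 1 L, S^z = 0)-sector ground states of
hubbardTorusTT' L 1 t′ U, seam twist). Producer: the (ii-b) shared-dual t′-segment bundle(s) at the
station with corner floors under the bar (skeleton bc/SegmentFanCeiling_birth.lean: two half-segment
bundles split at the booked midpoint twin −1/4). [difficulty: L] -/
@[route_item "route-Ventures-CovLa214M2b"]
def SegmentFanCeiling : Prop :=
  ∀ tp ∈ Set.Icc (-3 / 10 : ℝ) (-1 / 5), ∀ U ∈ Set.Icc (29 / 5 : ℝ) (74 / 5), -3 / 10 ≤ tp * (2 - 29 / 5 / U) → Summit.Ventures.CertifiedManyBodySolver.Observables.ObsStiffnessSeqCeilingAt tp U 1 (4364687 / 10000000)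

/-- item stmt-Ventures-26184 · crux · rank 3 · open · by planner
why it might fail: the corner objective X₀(−3/10) read at sources down to s = −357/740 has kinematic scale 0.4392 vs bar 0.4365 (0.6 % to earn) but the objective/source K₂-mismatch grows with |s + 3/10|; the far-vertex alternative needs w₁ ≤ 0.4365 with w₁ a-priori ≈ 0.436 (j298588, undecided).
sources: KomaTasaki1994, ScalapinoWhiteZhang1993, WangEtAl2024, HazraVermaRanderia2019
[crux] TRANSPORT FAN — for every t′ ∈ [−3/10, −1/5], U ∈ [29/5, 74/5] with t′(2 − (29/5)/U) ≤ −3/10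
(apex source left of the box, down to −357/740 at (−3/10, 74/5)): ObsStiffnessSeqCeilingAt t′ U 1
0.4364687. Producer (edition E1): the overhang bundle(s) at the station read with the CORNER
objective X₀(−3/10) (slot σ = −3/10 ≤ t′; skeleton bc/TransportFanCeiling_birth.lean, two
half-overhang bundles split at the booked twin −579/1480); alternatives: left-edge U-bundle (E2),
far-vertex lens on U ≥ 46/5 (`laBoxE_slab46o5_stiffnessLeaf_of_farVertex_fsumRow`, leg j298588) +
point fans below. [difficulty: L] -/
@[route_item "route-Ventures-CovLa214M2b"]
def TransportFanCeiling : Prop :=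
  ∀ tp ∈ Set.Icc (-3 / 10 : ℝ) (-1 / 5), ∀ U ∈ Set.Icc (29 / 5 : ℝ) (74 / 5), tp * (2 - 29 / 5 / U) ≤ -3 / 10 → Summit.Ventures.CertifiedManyBodySolver.Observables.ObsStiffnessSeqCeilingAt tp U 1 (4364687 / 10000000)

/-- item stmt-Ventures-26185 · assembly · rank 1 · closed · proved by Summit.Ventures.CertifiedManyBodySolver.Theorems.covLa214M2bAssembly_proof (prover) · by planner
sources: KomaTasaki1994, ScalapinoWhiteZhang1993
[assembly] SegmentFanCeiling → TransportFanCeiling → the rung leaf La214M2b_StiffnessBoxCeiling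
(closes_target; class rung, never summit credit). -/
@[route_item "route-Ventures-CovLa214M2b"]
def Assembly : Prop :=
  SegmentFanCeiling → TransportFanCeiling → Summit.Ventures.CertifiedManyBodySolver.Observables.La214M2b_StiffnessBoxCeiling

-- `Assembly` holds: proved by `Summit.Ventures.CertifiedManyBodySolver.Theorems.covLa214M2bAssembly_proof` (its module imports this route file, so no `_holds` link can be stated here).

/-! D-0027 §2.1 — DECIDING THEOREM (planner-authored via `route open/edit --closes-file`; by planner-hubbard-m2-certneg-1-0 2026-08-28T06:25:10Z):
its hypotheses are this route's items and its conclusion the registered leaf `Summit.Ventures.CertifiedManyBodySolver.Observables.La214M2b_StiffnessBoxCeiling` (rung MO-S2, D-0061) (glue_lint), and it elaborates with this file. -/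

@[closes "route-Ventures-CovLa214M2b"] theorem closes (h₁ : SegmentFanCeiling) (h₂ : TransportFanCeiling) :
    Summit.Ventures.CertifiedManyBodySolver.Observables.La214M2b_StiffnessBoxCeiling :=
  Summit.Ventures.CertifiedManyBodySolver.Observables.La214M2b_StiffnessBoxCeiling_of_laBoxE_leaf le_rfl
    fun tp htp U hU => by
      rcases le_total (-3 / 10 : ℝ) (tp * (2 - 29 / 5 / U)) with h | h
      · exact h₁ tp htp U hU h
      · exact h₂ tp htp U hU h

end Summit.Ventures.CertifiedManyBodySolver.Theses.CovLa214M2b
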